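import Literature.NumberTheory.EllipticCurves.Tian2014.CMPointSystemGenusBridge
import HarnessLib

/-!
# Monsky 1990 Thm. 5.5 transplanted onto Tian's CM points on ALL of case (13) — `N = 2pq`, `p ≡ 5 (8)`, `q ≡ 3 (8)`,
# EITHER sign of `(p/q)`: the genus-field Galois data, the Monsky displays and `y_{2n} ∉ 2E(K)⁻ + E[2]` (M-y) on the
# loud half `(p/q) = +1` as well, and the restated system fact on the family `{q ≡ 3 (mod 8)}`

Cell `bsd-monsky` (prover-A seat, g10). Monsky's Theorem 5.14 (13) (`N = 2p₃p₅`, p. 66) carries NO Legendre proviso: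
Theorem 5.5 (p. 62) proves `S_{2D} ∉ 2Λ_{2D} + T` for `D = p₃p₅` whatever `(p₅/p₃)` is. The cell's enclosure
transplanted Thm. 5.5 onto Tian's CM points only on the silent half `𝒮⁻ = {(p/q) = −1}`
(`CMPointSystemGenusBridge.monskyDisplays_of_genusTheory`, hypothesis `hpq : J(p | q) = -1`). This file removes
the proviso on `q ≡ 3 (mod 8)`: on the loud half `(p/q) = +1` the genus rule (Tian, Notations J122–123) reads
`σ_{[𝔭_p]}√p = −√p` (`(2q/p) = (2/p)(q/p) = −1`), `σ_{[𝔭_p]}√−q = √−q` (`(p/q) = 1`), `σ_{[𝔭_q]}√p = √p`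
(`(q/p) = 1`), `σ_{[𝔭_q]}√−q = −√−q` (`(2p/q) = (2/q)(p/q) = −1`) — the roles of `[𝔭_p]` and `[𝔭_q]` are EXCHANGED
relative to `𝒮⁻ ∩ {q ≡ 3 (8)}`, the product `σ_m = σ_{[𝔭_p]}σ_{[𝔭_q]}` acts exactly as before (negates `√p`, `√−q`,
fixes `√2 = √−2n/(√p√−q)`), so: (H4) holds (`[𝔭_p], [𝔭_q], m ∉ G²`, `|G²|` odd), `m ∉ G²`, the genus character of
the second twist `d = pq` is trivial exactly on `G² ∪ mG²`, the ambiguous class `B = [𝔭_q] ∉ {1, m}` and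
`J = [𝔭_q] ∉ G_D`, and Lemma 5.4 applies verbatim (it uses only `(2/p) = −1` and `q ≡ 3 (8)`, PROOF-A Lemma 5.2 /
`DescentLemmaPoints.lemma54_point`). Hence `MonskyDisplays` and K1 = `MinusY` on ALL of `{p ≡ 5 (8), q ≡ 3 (8)}`
(`monskyDisplays_of_genusTheoryDisplays_three_mod_eight`, `minusY_of_genusTheoryDisplays_three_mod_eight`), and K1 on
the family from the system sentences taken as a BINDER (`exists_printed_grossZagier_minusY_of_threeModEightSystem`:
the sentences of `tian2014_system_sMinus_genus` indexed by `{q ≡ 3 (8)}`, both symbols; no new named fact — the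
typer may name it). Nothing asserted; PROOF-A v3.4 (𝒮⁻) is
untouched; on `(15)⁺ = {q ≡ 7 (8), (p/q) = +1}` Monsky's proof (p. 64 L9–L14, Lemma 5.6) needs the real-locus
positions of two ambiguous-class points, which Tian's Thm. 2.8 skeleton does not display — NOT transplanted here.
[cite: Monsky1990MockHeegner, Thm. 5.5 and Lemma 5.4 (p. 62), Thm. 5.14 (13) (p. 66), Thm. 4.7 proof (p. 57)]
[cite: Tian2014, Notations (J122–123 = p0004 L82–p0005 L59), Def. 2.7, Thm. 2.8 (p0011 L25–L44)]
-/

noncomputable section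

open scoped Classical NumberTheorySymbols

namespace Literature.NumberTheory.EllipticCurves.Monsky1990

variable {G : Type*} [CommGroup G] {H : Type*} [Field H] [CharZero H]

/-- An automorphism sends a square root of `c ∈ H` to `±` itself. [folklore] -/
private theorem map_eq_or_eq_neg' (g : H ≃ₐ[ℚ] H) {s c : H} (hs : s ^ 2 = c) (hc : g c = c) :
    g s = s ∨ g s = -s := by
  have : (g s) ^ 2 = s ^ 2 := by rw [← map_pow, hs, hc]
  exact sq_eq_sq_iff_eq_or_eq_neg.mp this

/-! ### §1 The genus rule on the loud half of case (13): `p ≡ 5 (8)`, `q ≡ 3 (8)`, `(p/q) = +1` -/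

/-- **The actions of the ramified classes `[𝔭_p]`, `[𝔭_q]` on `√p`, `√−q` on `(13)⁺`** (`p ≡ 5 (8)`, `q ≡ 3 (8)`,
`(p/q) = +1`) from Tian's genus rule: `σ_{[𝔭_p]}` negates `√p` (`(2q/p) = (2/p)(q/p) = −1`) and fixes `√−q`
(`(p/q) = 1`); `σ_{[𝔭_q]}` fixes `√p` (`(q/p) = (p/q) = 1`) and negates `√−q` (`(2p/q) = (2/q)(p/q) = −1`) — the
roles of `[𝔭_p]` and `[𝔭_q]` on `𝒮⁻ ∩ {q ≡ 3 (8)}` (`ramifiedClassActions_of_genusRule`) exchanged.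
[cite: Tian2014, Notations (pp. 122–123)] -/
theorem ramifiedClassActions_of_genusRule_plus (art : G →* (H ≃ₐ[ℚ] H)) {p q : ℕ}
    (hp8 : p % 8 = 5) (hq8 : q % 8 = 3) (hpq : J(p | q) = 1) {cp cq : G}
    {sqrtP sqrtNegQ : H} (hP : sqrtP ^ 2 = p) (hQ : sqrtNegQ ^ 2 = -q)
    (r1 : art cp sqrtP = sqrtP ↔ J(2 * q | p) = 1) (r2 : art cp sqrtNegQ = sqrtNegQ ↔ J(p | q) = 1)
    (r3 : art cq sqrtP = sqrtP ↔ J(q | p) = 1) (r4 : art cq sqrtNegQ = sqrtNegQ ↔ J(2 * p | q) = 1) :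
    art cp sqrtP = -sqrtP ∧ art cp sqrtNegQ = sqrtNegQ ∧ art cq sqrtP = sqrtP ∧
      art cq sqrtNegQ = -sqrtNegQ := by
  have hq2 : q % 2 = 1 := by omega
  have j2p : J(2 | p) = -1 := jacobiSym_two_of_mod_eight_five hp8
  have jqp : J(q | p) = 1 := by rw [jacobiSym_swap_of_mod_four_one (by omega) hq2, hpq]
  have j2qp : J(2 * q | p) = -1 := by rw [jacobiSym.mul_left, j2p, jqp]; norm_num
  have j2pq : J(2 * p | q) = -1 := by
    rw [jacobiSym.mul_left, hpq, jacobiSym_two_of_mod_eight_three hq8]; norm_num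
  refine ⟨?_, r2.mpr hpq, r3.mpr jqp, ?_⟩
  · have hne : art cp sqrtP ≠ sqrtP := fun h => by rw [r1, j2qp] at h; norm_num at h
    rcases map_eq_or_eq_neg' (art cp) hP (by rw [map_natCast]) with h | h
    · exact absurd h hne
    · exact h
  · have hne : art cq sqrtNegQ ≠ sqrtNegQ := fun h => by rw [r4, j2pq] at h; norm_num at h
    rcases map_eq_or_eq_neg' (art cq) hQ (by rw [map_neg, map_natCast]) with h | h
    · exact absurd h hne
    · exact h

/-- **The Galois data D1 on `(13)⁺`** (`p ≡ 5 (8)`, `q ≡ 3 (8)`, `(p/q) = +1`): with `√2 := √−2n/(√p√−q)` and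
`√q := i√−q`, `√2² = 2`, `√q² = q`, and `σ_m = σ_{[𝔭_p]}σ_{[𝔭_q]}` fixes `√2`, negates `√p` and `√q`, `τ` fixes
`√2`, `√p` and negates `√q` — the SAME data as on `𝒮⁻ ∩ {q ≡ 3 (8)}` (`galoisData_of_genusRule` at `q ≡ 3 (8)`):
the two ramified classes exchange roles, their product does not change. These are exactly the inputs of Monsky's
Lemma 5.4 (`DescentLemmaPoints.lemma54_point`), which therefore applies on `(13)⁺` verbatim.
[cite: Tian2014, Notations (pp. 122–123), Def. 2.7 (p. 132)] [cite: Monsky1990MockHeegner, Lemma 5.4 and Thm. 5.5 (p. 62)] -/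
theorem galoisData_of_genusRule_plus (art : G →* (H ≃ₐ[ℚ] H)) (tau : H ≃ₐ[ℚ] H) {p q : ℕ} (hp : p.Prime)
    (hq : q.Prime) (hp8 : p % 8 = 5) (hq8 : q % 8 = 3) (hpq : J(p | q) = 1) {cp cq m : G}
    (hm : m = cp * cq) {im sqrtP sqrtNegQ sqrtNegTwoN : H} (him : im ^ 2 = -1) (hP : sqrtP ^ 2 = p)
    (hQ : sqrtNegQ ^ 2 = -q) (hN : sqrtNegTwoN ^ 2 = -(2 * p * q))
    (r1 : art cp sqrtP = sqrtP ↔ J(2 * q | p) = 1) (r2 : art cp sqrtNegQ = sqrtNegQ ↔ J(p | q) = 1)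
    (r3 : art cq sqrtP = sqrtP ↔ J(q | p) = 1) (r4 : art cq sqrtNegQ = sqrtNegQ ↔ J(2 * p | q) = 1)
    (hi : ∀ s, art s im = im) (hN' : ∀ s, art s sqrtNegTwoN = sqrtNegTwoN)
    (hτi : tau im = -im) (hτP : tau sqrtP = sqrtP) (hτQ : tau sqrtNegQ = sqrtNegQ)
    (hτN : tau sqrtNegTwoN = sqrtNegTwoN) :
    (sqrtNegTwoN / (sqrtP * sqrtNegQ)) ^ 2 = 2 ∧ (im * sqrtNegQ) ^ 2 = q ∧
    art m (sqrtNegTwoN / (sqrtP * sqrtNegQ)) = sqrtNegTwoN / (sqrtP * sqrtNegQ) ∧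
    art m sqrtP = -sqrtP ∧ art m (im * sqrtNegQ) = -(im * sqrtNegQ) ∧
    tau (sqrtNegTwoN / (sqrtP * sqrtNegQ)) = sqrtNegTwoN / (sqrtP * sqrtNegQ) ∧ tau sqrtP = sqrtP ∧
    tau (im * sqrtNegQ) = -(im * sqrtNegQ) := by
  have hp0 : (p : H) ≠ 0 := Nat.cast_ne_zero.mpr hp.ne_zero
  have hq0 : (q : H) ≠ 0 := Nat.cast_ne_zero.mpr hq.ne_zero
  have hsP : sqrtP ≠ 0 := by
    intro h; rw [h, zero_pow two_ne_zero] at hP; exact hp0 hP.symm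
  have hsQ : sqrtNegQ ≠ 0 := by
    intro h; rw [h, zero_pow two_ne_zero] at hQ; exact hq0 (neg_eq_zero.mp hQ.symm)
  obtain ⟨hcpP, hcpQ, hcqP, hcqQ⟩ := ramifiedClassActions_of_genusRule_plus art hp8 hq8 hpq hP hQ r1 r2 r3 r4
  -- `σ_m = σ_{[𝔭_p]} σ_{[𝔭_q]}`
  have hmP : art m sqrtP = -sqrtP := by
    rw [hm, map_mul, AlgEquiv.mul_apply, hcqP, hcpP]
  have hmQ : art m sqrtNegQ = -sqrtNegQ := by
    rw [hm, map_mul, AlgEquiv.mul_apply, hcqQ, map_neg, hcpQ]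
  refine ⟨?_, ?_, ?_, hmP, ?_, ?_, hτP, ?_⟩
  · rw [div_pow, mul_pow, hN, hP, hQ]
    field_simp
  · rw [mul_pow, him, hQ]; ring
  · rw [map_div₀, map_mul, hN' m, hmP, hmQ, mul_neg, neg_mul, neg_neg]
  · rw [map_mul, hi m, hmQ, mul_neg]
  · rw [map_div₀, map_mul, hτN, hτP, hτQ]
  · rw [map_mul, hτi, hτQ, neg_mul]

end Literature.NumberTheory.EllipticCurves.Monsky1990

/-! ### §2 The Monsky displays and M-y on all of case (13) -/

open NumberField Literature.NumberTheory.EllipticCurves.TianYuanZhang2017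

namespace Literature.NumberTheory.EllipticCurves.Tian2014.CMPointData

open Literature.NumberTheory.EllipticCurves.Monsky1990

/-- **THE MONSKY DISPLAYS FROM TIAN'S GENUS THEORY ON THE LOUD HALF OF CASE (13)**: for a system `D : CMPointData (pq)`
with `p ≡ 5 (8)`, `q ≡ 3 (8)`, `(p/q) = +1` and `Printed`, every conjunct of `MonskyDisplays` follows from the genus
theory of `K = ℚ(√−2pq)` as Tian prints it (the hypotheses of `monskyDisplays_of_genusTheory`, symbol `+1`): the
second twist `d = pq`, `θ′ = √p·√−q`, the ambiguous class `B = [𝔭_q]`, `J = [𝔭_q]` (the roles of `[𝔭_p]` and `[𝔭_q]`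
exchanged relative to `𝒮⁻`: `classGroupFacts_of_genusTheory` applied to `(cq, cp)`), the descent lemma
`twoDescentLemma_of_galoisData_three` (Monsky Lemma 5.4) on the same D1 data.
[cite: Monsky1990MockHeegner, Thm. 5.5 and Lemma 5.4 (p. 62), Thm. 4.7 proof (p. 57), Thm. 5.14 (13) (p. 66)]
[cite: Tian2014, Notations (pp. 122–123), Def. 2.7 (p. 132)] -/
theorem monskyDisplays_of_genusTheory_plus {p q : ℕ} (D : CMPointData (p * q)) (hP : D.Printed) (hp : p.Prime)
    (hq : q.Prime) (hp8 : p % 8 = 5) (hq8 : q % 8 = 3) (hpq : J(p | q) = 1)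
    {sqrtP sqrtNegQ : D.H} (hPs : sqrtP ^ 2 = p) (hQs : sqrtNegQ ^ 2 = -q)
    {cp cq : ClassGroup (𝓞 (GenusField (2 * (p * q))))} (hm : D.piPrime = cp * cq) (hcp2 : cp * cp = 1)
    (hcq2 : cq * cq = 1)
    (h2tor : ∀ t : ClassGroup (𝓞 (GenusField (2 * (p * q)))), t * t = 1 → t = 1 ∨ t = D.piPrime ∨ t = cp ∨ t = cq)
    (hsq : ∀ t, IsSquare t ↔ (D.art t sqrtP = sqrtP ∧ D.art t sqrtNegQ = sqrtNegQ))
    (r1 : D.art cp sqrtP = sqrtP ↔ J(2 * q | p) = 1) (r2 : D.art cp sqrtNegQ = sqrtNegQ ↔ J(p | q) = 1)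
    (r3 : D.art cq sqrtP = sqrtP ↔ J(q | p) = 1) (r4 : D.art cq sqrtNegQ = sqrtNegQ ↔ J(2 * p | q) = 1)
    (hτP : D.tau sqrtP = sqrtP) (hτQ : D.tau sqrtNegQ = sqrtNegQ) (hcP : D.conj sqrtP = sqrtP)
    (hcQ : D.conj sqrtNegQ = -sqrtNegQ) : D.MonskyDisplays := by
  have hq4 : q % 4 = 3 := by omega
  have hP' := hP
  obtain ⟨-, -, -, -, hart, ⟨htaui, htauN, -⟩, -, -, -, -, -⟩ := hP'
  obtain ⟨hsP, hsQ⟩ := sqrt_ne_zero_of_prime hp hq hPs hQs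
  have hN : D.sqrtNegTwoN ^ 2 = -(2 * p * q) := by
    rw [D.sqrtNegTwoN_sq]; push_cast; ring
  -- D1 (the same data as on `𝒮⁻ ∩ {q ≡ 3 (8)}`)
  obtain ⟨h2sq, hqsq, hσ2, hσP, hσQ, hτ2, -, hτq⟩ :=
    galoisData_of_genusRule_plus D.art D.tau hp hq hp8 hq8 hpq hm D.im_sq hPs hQs hN r1 r2 r3 r4
      (fun s => (hart s).1) (fun s => (hart s).2) htaui hτP hτQ htauN
  obtain ⟨hcpP, hcpQ, hcqP, hcqQ⟩ := ramifiedClassActions_of_genusRule_plus D.art hp8 hq8 hpq hPs hQs r1 r2 r3 r4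
  -- (b), (d): the class-group facts with the roles of `cp`, `cq` exchanged
  have hm' : D.piPrime = cq * cp := hm.trans (mul_comm cp cq)
  have h2tor' : ∀ t : ClassGroup (𝓞 (GenusField (2 * (p * q)))), t * t = 1 →
      t = 1 ∨ t = D.piPrime ∨ t = cq ∨ t = cp := by
    intro t ht
    rcases h2tor t ht with h | h | h | h
    · exact Or.inl h
    · exact Or.inr (Or.inl h)
    · exact Or.inr (Or.inr (Or.inr h))
    · exact Or.inr (Or.inr (Or.inl h))
  have hcpQ' : D.art cp sqrtNegQ = if q % 8 = 3 then sqrtNegQ else -sqrtNegQ := by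
    rw [if_pos hq8]; exact hcpQ
  obtain ⟨hmsq, hodd, ⟨-, hcq1, hcqm⟩, h3case, -⟩ :=
    classGroupFacts_of_genusTheory D.art hPs hQs hsP hsQ hm' hcq2 hcp2 h2tor' hsq hcqP hcqQ hcpP hcpQ'
  -- (c): the second twist `d = pq`, `θ′ = √p·√−q`
  have hsec := secondTwist_of_galoisData (D.art D.piPrime) D.tau D.conj hq4 D.im_sq hPs hQs
    (hart D.piPrime).1 hσP (by rw [if_pos hq8]; exact hσQ) hτP hτQ hcP hcQ
  obtain ⟨hθ2, hσθ, hτθ, hcθ⟩ := hsec.1 hq8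
  obtain ⟨hGD, hJ⟩ := h3case hq8
  have hn7 : (p * q) % 8 = 7 := by rw [Nat.mul_mod, hp8, hq8]
  have hθ2' : (sqrtP * sqrtNegQ) ^ 2 = algebraMap ℚ D.H (-((p * q : ℕ) : ℚ)) := by
    rw [hθ2, map_neg, map_natCast]
  have hθ0 : sqrtP * sqrtNegQ ≠ 0 := mul_ne_zero hsP hsQ
  refine ⟨p * q, sqrtP * sqrtNegQ, Nat.mul_ne_zero hp.ne_zero hq.ne_zero, hθ2', hθ0, cq, cq, hσθ, hτθ, hcθ,
    hcq2, hcq1, hcqm, ?_, hmsq, hodd, ?_, ?_⟩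
  · intro t
    rw [D.chi_eq_one_iff, hGD t]
  · unfold chi
    rw [if_neg hJ]
  · rw [if_pos hn7]
    exact D.twoDescentLemma_of_galoisData_three hP hp hq hp8 hq8 h2sq hPs hqsq hσ2 hσP hσQ hτ2 hτP hτq
      (Dvd.intro_left 2 (by ring)) (Nat.mul_ne_zero hp.ne_zero hq.ne_zero) hθ2' hθ0

/-- **`Printed ∧ GenusTheoryDisplays ⟹ MonskyDisplays` on ALL of case (13)** — `p ≡ 5 (8)`, `q ≡ 3 (8)`, either sign
of `(p/q)` (`monskyDisplays_of_genusTheoryDisplays` on `(p/q) = −1`, `monskyDisplays_of_genusTheory_plus` on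
`(p/q) = +1`). [cite: Monsky1990MockHeegner, Thm. 5.5 (p. 62), Thm. 5.14 (13) (p. 66)] -/
theorem monskyDisplays_of_genusTheoryDisplays_three_mod_eight {p q : ℕ} (D : CMPointData (p * q)) (hP : D.Printed)
    (hp : p.Prime) (hq : q.Prime) (hp8 : p % 8 = 5) (hq8 : q % 8 = 3) (hG : D.GenusTheoryDisplays) :
    D.MonskyDisplays := by
  have hne : p ≠ q := fun h => by omega
  have hg : (p : ℤ).gcd q = 1 := by
    rw [Int.gcd_natCast_natCast]; exact (Nat.coprime_primes hp hq).mpr hne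
  rcases jacobiSym.eq_one_or_neg_one hg with hj | hj
  · obtain ⟨sqrtP, sqrtNegQ, cp, cq, hPs, hQs, hm, hcp2, hcq2, h2tor, hsq, r1, r2, r3, r4, hτP, hτQ, hcP, hcQ⟩ := hG
    exact D.monskyDisplays_of_genusTheory_plus hP hp hq hp8 hq8 hj hPs hQs hm hcp2 hcq2 h2tor hsq r1 r2 r3 r4
      hτP hτQ hcP hcQ
  · exact D.monskyDisplays_of_genusTheoryDisplays hP hp hq hp8 (by omega) hj hG

/-- **K1 on ALL of case (13): `y_{2pq} ∉ 2E(K)⁻ + E[2]` (M-y) for `p ≡ 5 (8)`, `q ≡ 3 (8)`, either sign of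
`(p/q)`**, from `Printed ∧ GenusTheoryDisplays` — Monsky Thm. 5.5 transplanted without the Legendre proviso.
[cite: Monsky1990MockHeegner, Thm. 5.5 (p. 62), Thm. 5.14 (13) (p. 66)] -/
theorem minusY_of_genusTheoryDisplays_three_mod_eight {p q : ℕ} (D : CMPointData (p * q)) (hP : D.Printed)
    (hp : p.Prime) (hq : q.Prime) (hp8 : p % 8 = 5) (hq8 : q % 8 = 3) (hG : D.GenusTheoryDisplays) :
    D.MinusY (Nat.mul_ne_zero hp.ne_zero hq.ne_zero) :=
  D.minusY_of_monskyDisplays _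
    (squarefree_two_mul_mul_of_primes hp hq (by omega) (by omega) (fun h => by omega)) hP
    (D.monskyDisplays_of_genusTheoryDisplays_three_mod_eight hP hp hq hp8 hq8 hG)

end Literature.NumberTheory.EllipticCurves.Tian2014.CMPointData

/-! ### §3 K1 on the family `{p ≡ 5 (8), q ≡ 3 (8)}` (both symbols) from the system sentences, stated as a binder -/

namespace Literature.NumberTheory.EllipticCurves.Tian2014

/-- **K1 on ALL of case (13) from the system sentences as a binder**: if for all `p ≡ 5 (8)`, `q ≡ 3 (8)` (either
symbol) there is a system `D : CMPointData (pq)` with `Printed`, the Gross–Zagier index relation and Gauss genus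
theory as printed — the three sentences of `tian2014_system_sMinus_genus`, here indexed by Monsky's case (13)
`N = 2p₃p₅` (p. 66, no Legendre proviso) instead of `𝒮⁻` (every sentence is printed for all square-free
`n ≡ 3 (mod 4)`, Tian Def. 2.7 / Thm. 2.8, resp. all `n`, TYZ Thm. 3.3, Tian's Notations: the index set is
immaterial to the source) — then each such `D` also carries M-y (`y_{2pq} ∉ 2E(K)⁻ + E[2]`). The hypothesis is a
BINDER (no new named fact); nothing asserted.
[cite: Monsky1990MockHeegner, Thm. 5.5 (p. 62), Thm. 5.14 (13) (p. 66)] [cite: TianYuanZhang2017, Thm. 3.3]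
[cite: Tian2014, Def. 2.7, Thm. 2.8 (p0011 L25–L44 = J132), Notations (J122–123)] -/
theorem exists_printed_grossZagier_minusY_of_threeModEightSystem
    (h : ∀ p q : ℕ, (hp : p.Prime) → (hq : q.Prime) → p % 8 = 5 → q % 8 = 3 →
      ∃ D : CMPointData (p * q), D.Printed ∧
        D.GrossZagierScriptL (Nat.mul_ne_zero hp.ne_zero hq.ne_zero) ∧ D.GenusTheoryDisplays) :
    ∀ p q : ℕ, (hp : p.Prime) → (hq : q.Prime) → p % 8 = 5 → q % 8 = 3 →
      ∃ D : CMPointData (p * q), D.Printed ∧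
        D.GrossZagierScriptL (Nat.mul_ne_zero hp.ne_zero hq.ne_zero) ∧
        D.MinusY (Nat.mul_ne_zero hp.ne_zero hq.ne_zero) := by
  intro p q hp hq hp8 hq8
  obtain ⟨D, hP, hGZ, hG⟩ := h p q hp hq hp8 hq8
  exact ⟨D, hP, hGZ, D.minusY_of_genusTheoryDisplays_three_mod_eight hP hp hq hp8 hq8 hG⟩

end Literature.NumberTheory.EllipticCurves.Tian2014

end
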